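import Mathlib
import HarnessLib
import Summits.ValiantsHypothesis.ValiantsHypothesis.Theorems.LacunarySymmetroidMatrixDescartesOsculationLawPeelLocalBranch

/-!
# ValiantsHypothesis / LacunarySymmetroid — crux `MatrixDescartes` (stmt-ValiantsHypothesis-18050, V1),
# line `Cruxes/MatrixDescartes/Lines/osculation_law.lean` («osculation-law»), stub `stub_peel` (ALL ranks):
# COLLAPSING ROOTS RAISE MULTIPLICITY — LOCALIZED ROLLE (rank-free; piece (β1) of NOTE-p7g12-peel-general-r-sizing.md)

When `k + 1` distinct roots of the fibres `Φ(t_n, ·)` collapse to a point `b*` as `t_n → t*`, `b*` is a root of multiplicity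
`≥ k + 1` of `Φ(t*, ·)` — by ROLLE inside the shrinking interval and continuity of `(t, b) ↦ ∂_b^jΦ(t, b)`; no continuity of
roots is used.  This is the "k branch ends arriving at (t*, b*) cost multiplicity k" half of the end-cost lemma of the
component architecture (§3 (β1) of the memo); the other half (multiplicity ⇒ order of vanishing of the coefficient, (β2)) is
`no_fold_hyperbolic` at multiplicity two and open beyond.

* `chain_le`, `exists_chain_deriv_roots` — Rolle for an `ℕ`-indexed strictly increasing chain of `n` zeros of a
  differentiable `q`: an interlacing chain of `n - 1` zeros of `q'`.
* `exists_chain_iterate_derivative_roots` — iterated for `p : ℝ[X]`: `n` increasing roots of `p` in `[lo, hi]` give `n - j`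
  increasing roots of `p^{(j)}` in `[lo, hi]`.
* `eval_iterate_pderiv_one_eq` — `∂_b^jΦ(t, b) = (P t)^{(j)}(b)` for the vertical family; `continuous_eval₂`.
* **`succ_le_rootMultiplicity_of_collapse`** — the statement above.

Honest framing: a rank-free LEMMA toward the OPEN stub `stub_peel` (all `r`); nothing of the summit is proved; `VP ≠ VNP` is
NOT proved.  No definitions, no named facts.
-/

-- `Summit.ValiantsHypothesis.ValiantsHypothesis.…` is the tree's mandated single-conjunct layout (Sub = Summit).
set_option linter.dupNamespace false

noncomputable section

namespace Summit.ValiantsHypothesis.ValiantsHypothesis.Theorems.LacunarySymmetroidMatrixDescartes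

open Polynomial Set Filter
open MvPolynomial (pderiv)
open scoped BigOperators Topology

namespace OsculationPeel

/-! ### Localized Rolle for increasing root tuples (`ℕ`-indexed, no dependent casts) -/

/-- A chain `x 0 < x 1 < … < x (n-1)` is monotone on `{i < n}`. [folklore] -/
theorem chain_le {x : ℕ → ℝ} {n : ℕ} (hx : ∀ i, i + 1 < n → x i < x (i + 1)) :
    ∀ i j, i ≤ j → j < n → x i ≤ x j := by
  intro i j hij hjn
  induction j with
  | zero => rw [Nat.le_zero.1 hij]
  | succ j ih =>
    rcases Nat.lt_or_ge i (j + 1) with h | h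
    · exact le_trans (ih (Nat.lt_succ_iff.1 h) (by omega)) (hx j hjn).le
    · rw [le_antisymm hij h]

/-- **Rolle, tuple form**: from `n` strictly increasing zeros `x 0 < … < x (n-1)` of a differentiable `q` we get `n - 1`
strictly increasing zeros `y i ∈ (x i, x (i+1))` of `q'`. [folklore] -/
theorem exists_chain_deriv_roots {q q' : ℝ → ℝ} (hq : ∀ x, HasDerivAt q (q' x) x) (n : ℕ) (x : ℕ → ℝ)
    (hx : ∀ i, i + 1 < n → x i < x (i + 1)) (hroot : ∀ i, i < n → q (x i) = 0) :
    ∃ y : ℕ → ℝ, (∀ i, i + 1 < n → x i < y i ∧ y i < x (i + 1)) ∧ (∀ i, i + 2 < n → y i < y (i + 1)) ∧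
      ∀ i, i + 1 < n → q' (y i) = 0 := by
  have hR : ∀ i, i + 1 < n → ∃ c ∈ Ioo (x i) (x (i + 1)), q' c = 0 := by
    intro i hi
    refine exists_hasDerivAt_eq_zero (hx i hi) (fun c _ => (hq c).continuousAt.continuousWithinAt) ?_
      (fun c _ => hq c)
    rw [hroot i (by omega), hroot (i + 1) hi]
  classical
  refine ⟨fun i => if hi : i + 1 < n then Classical.choose (hR i hi) else 0, fun i hi => ?_, fun i hi => ?_,
    fun i hi => ?_⟩
  · simp only [dif_pos hi]; exact (Classical.choose_spec (hR i hi)).1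
  · have hi' : i + 1 < n := by omega
    simp only [dif_pos hi, dif_pos hi']
    exact lt_trans (Classical.choose_spec (hR i hi')).1.2 (Classical.choose_spec (hR (i + 1) hi)).1.1
  · simp only [dif_pos hi]; exact (Classical.choose_spec (hR i hi)).2

/-- **Iterated localized Rolle for polynomials**: `n` strictly increasing roots of `p` in `[lo, hi]` give `n - j` strictly
increasing roots of `p^{(j)}` in `[lo, hi]`. [folklore] -/
theorem exists_chain_iterate_derivative_roots (j : ℕ) :
    ∀ (n : ℕ) (p : ℝ[X]) (x : ℕ → ℝ) (lo hi : ℝ), (∀ i, i + 1 < n → x i < x (i + 1)) → (∀ i, i < n → p.IsRoot (x i)) →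
      (∀ i, i < n → lo ≤ x i ∧ x i ≤ hi) →
      ∃ y : ℕ → ℝ, (∀ i, i + 1 + j < n → y i < y (i + 1)) ∧ (∀ i, i + j < n → (derivative^[j] p).IsRoot (y i)) ∧
        ∀ i, i + j < n → lo ≤ y i ∧ y i ≤ hi := by
  induction j with
  | zero =>
    intro n p x lo hi hx hroot hbd
    exact ⟨x, fun i hi => hx i (by omega), fun i hi => hroot i (by omega), fun i hi => hbd i (by omega)⟩
  | succ j ih =>
    intro n p x lo hi hx hroot hbd
    obtain ⟨y, hyI, hy, hyr⟩ := exists_chain_deriv_roots (q := fun s => p.eval s) (q' := fun s => (derivative p).eval s)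
      (fun s => Polynomial.hasDerivAt p s) n x hx (fun i hi => hroot i hi)
    -- `y` is a chain of `n - 1` roots of `p'` in `[lo, hi]`
    have hybd : ∀ i, i < n - 1 → lo ≤ y i ∧ y i ≤ hi := fun i hi => by
      have h1 := hyI i (by omega)
      exact ⟨le_trans (hbd i (by omega)).1 h1.1.le, le_trans h1.2.le (hbd (i + 1) (by omega)).2⟩
    obtain ⟨z, hz, hzr, hzbd⟩ := ih (n - 1) (derivative p) y lo hi (fun i hi => hy i (by omega))
      (fun i hi => hyr i (by omega)) hybd
    refine ⟨z, fun i hi => hz i (by omega), fun i hi => ?_, fun i hi => hzbd i (by omega)⟩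
    rw [Function.iterate_succ_apply]
    exact hzr i (by omega)

/-! ### The vertical family: iterated `b`-derivatives and continuity -/

/-- `∂_b^jΦ(t, b) = (P t)^{(j)}(b)`. [folklore] -/
theorem eval_iterate_pderiv_one_eq (Φ : MvPolynomial (Fin 2) ℝ) (P : ℝ → ℝ[X])
    (hP : ∀ t b, (P t).eval b = MvPolynomial.eval ![t, b] Φ) (j : ℕ) (t b : ℝ) :
    MvPolynomial.eval ![t, b] ((pderiv 1)^[j] Φ) = (derivative^[j] (P t)).eval b := by
  induction j generalizing Φ P with
  | zero => simpa using (hP t b).symm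
  | succ j ih =>
    rw [Function.iterate_succ_apply, Function.iterate_succ_apply]
    exact ih (pderiv 1 Φ) (fun t => derivative (P t)) (fun t b => (eval_pderiv_one_eq_derivative Φ P hP t b).symm)

/-- `(t, b) ↦ Φ(t, b)` is continuous. [folklore] -/
theorem continuous_eval₂ (Φ : MvPolynomial (Fin 2) ℝ) :
    Continuous (fun p : ℝ × ℝ => MvPolynomial.eval ![p.1, p.2] Φ) :=
  (contDiff_eval₂ Φ).continuous

/-! ### Collapsing roots raise multiplicity -/

/-- **Collapsing roots raise multiplicity.**  If `t_n → t*` and each fibre `Φ(t_n, ·) = P (t_n)` has `k + 1` strictly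
increasing roots `x n 0 < … < x n k` whose extreme members tend to `b*`, then `b*` is a root of `P t*` of multiplicity
`≥ k + 1` (`P t* ≢ 0`).  Localized Rolle + continuity of `∂_b^kΦ`; no continuity of roots. [folklore] -/
theorem succ_le_rootMultiplicity_of_collapse (Φ : MvPolynomial (Fin 2) ℝ) (P : ℝ → ℝ[X])
    (hP : ∀ t b, (P t).eval b = MvPolynomial.eval ![t, b] Φ) {tstar bstar : ℝ} (hP0 : P tstar ≠ 0) {k : ℕ}
    (t : ℕ → ℝ) (ht : Tendsto t atTop (𝓝 tstar)) (x : ℕ → ℕ → ℝ) (hx : ∀ n i, i + 1 < k + 1 → x n i < x n (i + 1))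
    (hroot : ∀ n i, i < k + 1 → (P (t n)).IsRoot (x n i)) (hlo : Tendsto (fun n => x n 0) atTop (𝓝 bstar))
    (hhi : Tendsto (fun n => x n k) atTop (𝓝 bstar)) :
    k + 1 ≤ (P tstar).rootMultiplicity bstar := by
  by_contra hlt
  push Not at hlt
  set m := (P tstar).rootMultiplicity bstar with hm
  -- `m ≤ k`: Rolle `m` times inside `[x n 0, x n k]` gives a root `y n` of `(P (t n))^{(m)}` there
  have hy : ∀ n, ∃ y, x n 0 ≤ y ∧ y ≤ x n k ∧ (derivative^[m] (P (t n))).IsRoot y := by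
    intro n
    obtain ⟨y, -, hyr, hybd⟩ := exists_chain_iterate_derivative_roots m (k + 1) (P (t n)) (x n) (x n 0) (x n k)
      (hx n) (hroot n) (fun i hi => ⟨chain_le (hx n) 0 i (Nat.zero_le i) hi, chain_le (hx n) i k (by omega) (by omega)⟩)
    exact ⟨y 0, (hybd 0 (by omega)).1, (hybd 0 (by omega)).2, hyr 0 (by omega)⟩
  choose y hy0 hy1 hyr using hy
  have hyt : Tendsto y atTop (𝓝 bstar) := tendsto_of_tendsto_of_tendsto_of_le_of_le hlo hhi hy0 hy1
  -- continuity of `(t, b) ↦ ∂_b^mΦ(t, b)` along `(t n, y n) → (t*, b*)`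
  have hcont := ((continuous_eval₂ ((pderiv 1)^[m] Φ)).tendsto (tstar, bstar)).comp (ht.prodMk_nhds hyt)
  have hzero : (fun n => MvPolynomial.eval ![t n, y n] ((pderiv 1)^[m] Φ)) = fun _ => 0 := by
    funext n
    rw [eval_iterate_pderiv_one_eq Φ P hP]
    exact hyr n
  have hlim : MvPolynomial.eval ![tstar, bstar] ((pderiv 1)^[m] Φ) = 0 := by
    have h2 : Tendsto (fun n => MvPolynomial.eval ![t n, y n] ((pderiv 1)^[m] Φ)) atTop (𝓝 0) := by
      rw [hzero]; exact tendsto_const_nhds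
    exact tendsto_nhds_unique hcont h2
  rw [eval_iterate_pderiv_one_eq Φ P hP] at hlim
  -- but multiplicity EXACTLY `m` means `(P t*)^{(m)}(b*) ≠ 0`
  have hnot : ¬ m < (P tstar).rootMultiplicity bstar := by rw [← hm]; exact lt_irrefl m
  rw [lt_rootMultiplicity_iff_isRoot_iterate_derivative hP0] at hnot
  push Not at hnot
  obtain ⟨j, hjm, hj⟩ := hnot
  rcases hjm.lt_or_eq with hjlt | rfl
  · exact hj (isRoot_iterate_derivative_of_lt_rootMultiplicity (by rw [← hm]; exact hjlt))
  · exact hj hlim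

end OsculationPeel

end Summit.ValiantsHypothesis.ValiantsHypothesis.Theorems.LacunarySymmetroidMatrixDescartes

end
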